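import Summits.NavierStokesRegularity.NavierStokesRegularity.Theorems.ScenarioCensusScalingSpectrumCentre
import Summits.NavierStokesRegularity.NavierStokesRegularity.Theorems.ScenarioCensusRotationOrderAxis
import HarnessLib

/-!
# LINE «scaling-spectrum» port, part 3/3 (REV 2): rotated DSS `Row_R2cT` and the apex `Row_DapT`, PROVED; census KEYS `Row_D7bi` / `Row_D7nc` /
# `Row_D7cc` / `Row_D7ap` / `Row_R4cc` + `_excluded`

Re-homed for the scenario census (typer seat ns-census-typer-1 g7; the cells are MEMBERS OF RECORD «DECIDED IN KERNEL IN FILES» of rows D7 / R4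
since census v1.68 (lead g9; critic idea-crit-3 PASS + RE-STAMP 19:11:46Z; ref ns-census-ref g8 PRE-CHECK ✓ §13.14 [1/6]; lit §21.20); this port makes
them TREE-decided): VERBATIM PORT of ns-idea-2 LINE g11-1 «scaling-spectrum» REV 2, `pub/ideators/ns-idea-2/lines/scaling-spectrum/line-scaling-spectrum.lean`
sha16 ae596ee6747cac4b (756 l., lean check rc 0, 0 sorry), split for the 400-line rule into `ScenarioCensusScalingSpectrum` (the log-scaling group, rows
`Row_DdenseT` / `Row_DbiT` / `Row_DncT` + `_holds`, `row_DbiT_of_row_DncT`, the lattice-spectrum display) → `…ScalingSpectrumCentre` (DSS about two centres: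
`Row_D2cT` + `_holds`, `atMostOneCentre_of_nontrivial`) → `…ScalingSpectrumRotated` (REV 2: rotated DSS `Row_R2cT`, the apex `Row_DapT` + `_holds`; census
KEYS).  Lean text VERBATIM in namespace `…Theorems.ScenarioCensus.ScalingSpectrum` (the line's `…Lines.ScalingSpectrum` re-homed); port edits: `local notation
"E3"` → `abbrev E3`, `[folklore]` dropped from the docstrings of the six parameterless row `def`s (gate relocation rule), fourteen one-line docstrings added, lemmas that restate already-landed tree declarations taken BY NAME (gate lint `dedup.landed`): `not_cyclic_of_irrational` = `RotationOrder.not_cyclic_of_irrational`, `rotZ_neg_rotZ` = `RotationOrder.rotZ_neg_rotZ`, `rotZ_rotZ_neg` = `RotationOrder.rotZ_rotZ_neg`, `rotZ_add_vec` = `ScrewBlowdown.rotZ_add_vec`, `rotZ_neg_vec` = `RotationOrder.rotZ_neg_vec`, `rotZ_sub_vec` = `ScrewBlowdown.rotZ_sub_vec`, `rotZ_comm` = `RotationOrder.rotZ_comm`;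
REV 2's «copies of the rotation-order helpers» are not re-declared where the tree already has them (gate lint `dedup.landed`): taken BY NAME from
`…ScenarioCensus.RotationOrder` / `…ScrewBlowdown`, and `rotZ_smul_vec` (tree twin in a non-importable theses-cone module) is a local `have` at its two
use sites (proof-only diffs).

No census VALUE is moved here (rows D7 / R4 keep their values; the members become TREE-decided by name); NS regularity is NOT proved; no summit
statement is proved by this file.
-/

noncomputable section

-- the summit and its single problem share the name `NavierStokesRegularity` (D-0017 nested layout)
set_option linter.dupNamespace false

open Set Function Filter Topology

namespace Summit.NavierStokesRegularity.NavierStokesRegularity.Theorems.ScenarioCensus.ScalingSpectrum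

open Literature.Analysis Literature.Analysis.FluidPDE
open Summit.NavierStokesRegularity.NavierStokesRegularity.Theorems.PoloidalWindowDoorPoloidalWindowRigidityStrata
  (eq_zero_of_scaleInvariant)
open Summit.NavierStokesRegularity.NavierStokesRegularity.Theorems.PoloidalWindowDoorPoloidalWindowRigidityOneSlice
  (eq_zero_of_translate_eq_slice)

/-! ### §REV 2 (g11) — the ROTATED twin of the centre reading, and the APEX

Two more cells of the same instrument (the stabiliser of `u` in the parabolic similarity group), both
decided in the kernel, every REV 1 declaration above untouched:
* `Row_R2cT` — the R-block twin of `Row_D2cT`: `u` rotated-discretely-self-similar (Chae–Wolf 2017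
  Def. 1.1 `IsRotatedDSS`, VERTICAL rotation axis; `IsRdssAbout`, `isRdssAbout_zero_iff`) about TWO
  DISTINCT spatial centres `a ≠ b`, factors `c, d > 0`, `≠ 1`, ANY two angles `α, β` ⇒ `u ≡ 0` on the
  past.  The two rotated dilations `x ↦ a + cR_α(x − a)`, `x ↦ b + dR_β(x − b)` have commuting linear
  parts, so their commutator is the TRANSLATION by `w = (I − cR_α)(I − dR_β)(a − b)` (`rdil_comm_defect`),
  `w ≠ 0` because `cR_α − I` is injective for `c ≠ 1` (norms; `eq_zero_of_smul_rotZ_eq`), every slice is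
  `w`-periodic (`translate_of_two_rdss_centres`) and census A13 (tree
  `ScenarioCensus.PeriodicGauge.periodic_typeI_liouville_genuine`) kills the field.  [corollary weight:
  closure on A13; planar rotations only — two rotated dilations with NON-parallel rotation axes are not claimed]
* `Row_DapT` — APEX IN THE OPEN PAST: `u` discretely self-similar (factor `c > 0`, `c ≠ 1`) about a
  SPACE–TIME point `(t₁, x₁)` with `t₁ < 0` (`IsDssAboutST`; `isDssAboutST_zero_iff`) ⇒ `u ≡ 0` on the
  past, with NO engine: iterating the dilation (or its inverse) towards its fixed point `(t₁, x₁)`, near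
  which the class is bounded (`‖u(t,·)‖ ≤ C/√(−t)`, `t ≤ max(t,t₁) < 0` along the orbit), gives
  `‖u(t,x)‖ ≤ q^k · C/√(−max(t,t₁)) → 0` (`q = min(c, c⁻¹) < 1`).  («self-similar about a regular point is
  zero» — folklore BOOKKEEPING weight: the apex of a non-trivial DSS candidate on `(−∞,0)` is the terminal
  time `0` or later; apex `> 0` restricted to the past is the OPEN cell D7 again, shifted.)
Readings: `rdssCentre_unique_of_nontrivial`, `apex_not_in_past_of_nontrivial`.
-/

section Rev2

/-- `ℝ³` (the line's `local notation "E3"`, spelled as a reducible abbreviation for the tree). -/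
abbrev E3 := EuclideanSpace ℝ (Fin 3)

/-! #### planar rotation bookkeeping ([folklore]; copies of the «rotation-order» helpers) -/

-- `rotZ_neg_rotZ`: the line restates the tree's `RotationOrder.rotZ_neg_rotZ`; taken BY NAME (gate lint dedup.landed).

-- `rotZ_rotZ_neg`: the line restates the tree's `RotationOrder.rotZ_rotZ_neg`; taken BY NAME (gate lint dedup.landed).

-- `rotZ_add_vec`: the line restates the tree's `ScrewBlowdown.rotZ_add_vec`; taken BY NAME (gate lint dedup.landed).

-- `rotZ_neg_vec`: the line restates the tree's `RotationOrder.rotZ_neg_vec`; taken BY NAME (gate lint dedup.landed).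

-- `rotZ_sub_vec`: the line restates the tree's `ScrewBlowdown.rotZ_sub_vec`; taken BY NAME (gate lint dedup.landed).

-- `rotZ_smul_vec`: restates the tree's `FrequencyRigidity.MovingAdjointBernoulli.rotZ_smul_vec' (module not importable here: theses-cone, farm rc 75)`; not re-declared — its uses carry a local `have`.

-- `rotZ_comm`: the line restates the tree's `RotationOrder.rotZ_comm`; taken BY NAME (gate lint dedup.landed).

/-- `R_θ` is injective. -/
theorem rotZ_injective (θ : ℝ) : Function.Injective (rotZ θ : E3 → E3) := fun x y h => by
  simpa only [RotationOrder.rotZ_neg_rotZ] using congrArg (rotZ (-θ)) h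

/-- `c R_α` with `0 < c ≠ 1` fixes only the zero vector (take norms; `norm_rotZ`). [folklore] -/
theorem eq_zero_of_smul_rotZ_eq {c α : ℝ} (hc : 0 < c) (hc1 : c ≠ 1) {v : E3}
    (h : c • rotZ α v = v) : v = 0 := by
  have hn : c * ‖v‖ = ‖v‖ := by
    have e := congrArg (fun z : E3 => ‖z‖) h
    simpa only [norm_smul, Real.norm_of_nonneg hc.le, norm_rotZ] using e
  have h2 : (c - 1) * ‖v‖ = 0 := by rw [sub_mul, one_mul, hn, sub_self]
  rcases mul_eq_zero.1 h2 with h3 | h3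
  · exact absurd (sub_eq_zero.1 h3) hc1
  · exact norm_eq_zero.1 h3

/-! #### Rotated DSS about a centre; ROW R-2c-T -/

/-- `u` is **rotated-discretely-self-similar about the space–time point `(0, a)`** with factor `c` and the
VERTICAL rotation `R_α`: `c R_{−α} u(c²t, a + c R_α (x − a)) = u(t, x)` for all `t, x`.  For `a = 0` this is
the Literature notion `IsRotatedDSS c (rotZLIE α) u` (Chae–Wolf 2017, Def. 1.1; `isRdssAbout_zero_iff`);
for `α = 0` it is `IsDssAbout a c u` (`isRdssAbout_angle_zero_iff`). [cite: ChaeWolf2017, Def. 1.1] -/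
def IsRdssAbout (a : E3) (c α : ℝ) (u : ℝ → E3 → E3) : Prop :=
  ∀ t x, c • rotZ (-α) (u (c ^ 2 * t) (a + c • rotZ α (x - a))) = u t x

/-- Rotated DSS about the origin, unfolded. -/
theorem isRdssAbout_zero_iff {c α : ℝ} {u : ℝ → E3 → E3} :
    IsRdssAbout 0 c α u ↔ IsRotatedDSS c (rotZLIE α) u := by
  simp only [IsRdssAbout, IsRotatedDSS, rotZLIE_symm_apply, rotZLIE_apply, zero_add, sub_zero]

/-- Angle `0`: rotated DSS is plain DSS about the centre. -/
theorem isRdssAbout_angle_zero_iff {a : E3} {c : ℝ} {u : ℝ → E3 → E3} :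
    IsRdssAbout a c 0 u ↔ IsDssAbout a c u := by
  simp only [IsRdssAbout, IsDssAbout, neg_zero, rotZ_zero]

/-- ROW R-2c-T («two-centre rotated DSS», the R-block twin of `Row_D2cT`): a Type-I ancient mild field in
the KNSS gauge that is rotated-DSS (vertical rotation axes, any angles `α, β`, factors `c, d > 0`, `≠ 1`)
about TWO DISTINCT spatial centres `a ≠ b` vanishes on the past. -/
def Row_R2cT : Prop :=
  ∀ (C : ℝ) (u : ℝ → E3 → E3) (a b : E3) (c d α β : ℝ),
    IsTypeIAncientMild C u → a ≠ b → 0 < c → c ≠ 1 → 0 < d → d ≠ 1 →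
    IsRdssAbout a c α u → IsRdssAbout b d β u → ∀ t < 0, ∀ x, u t x = 0

/-- The rotated dilation `x ↦ a + c R_α (x − a)`. -/
def rdil (a : E3) (c α : ℝ) (x : E3) : E3 := a + c • rotZ α (x - a)

/-- Its inverse `x ↦ a + c⁻¹ R_{−α} (x − a)`. -/
def rdilInv (a : E3) (c α : ℝ) (x : E3) : E3 := a + c⁻¹ • rotZ (-α) (x - a)

/-- `rdil ∘ rdilInv = id`. -/
theorem rdil_rdilInv (a : E3) {c : ℝ} (hc : c ≠ 0) (α : ℝ) (x : E3) :
    rdil a c α (rdilInv a c α x) = x := by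
  -- port: the line's helper `rotZ_smul_vec` restates a tree lemma in a module not importable here (dedup.landed); local copy:
  have rotZ_smul_vec : ∀ (θ r : ℝ) (a : E3), rotZ θ (r • a) = r • rotZ θ a := fun θ r a => by
    ext i; fin_cases i <;> simp [rotZ] <;> ring
  simp only [rdil, rdilInv, add_sub_cancel_left, rotZ_smul_vec, smul_smul, mul_inv_cancel₀ hc, one_smul,
    RotationOrder.rotZ_rotZ_neg, add_sub_cancel]

/-- The commutator vector `w = (I − cR_α)(I − dR_β)(a − b)`. -/
def commVec (a b : E3) (c d α β : ℝ) : E3 :=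
  ((a - b) - d • rotZ β (a - b)) - c • rotZ α ((a - b) - d • rotZ β (a - b))

/-- The two composites of the rotated dilations differ by the CONSTANT vector `w` (their linear parts
`cR_α`, `dR_β` commute). [folklore] -/
theorem rdil_comm_defect (a b : E3) (c d α β : ℝ) (x : E3) :
    rdil a c α (rdil b d β x) = rdil b d β (rdil a c α x) + commVec a b c d α β := by
  simp only [rdil, commVec]
  ext i
  fin_cases i <;> simp [rotZ] <;> ring

/-- Invariance of every slice of `u` under the commutator translation. [folklore] -/
theorem translate_of_two_rdss_centres {u : ℝ → E3 → E3} {a b : E3} {c d α β : ℝ}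
    (hc : c ≠ 0) (hd : d ≠ 0) (h₁ : IsRdssAbout a c α u) (h₂ : IsRdssAbout b d β u) :
    ∀ s y, u s (y + commVec a b c d α β) = u s y := by
  -- port: local copy of `rotZ_smul_vec` (see `rdil_rdilInv`)
  have rotZ_smul_vec : ∀ (θ r : ℝ) (a : E3), rotZ θ (r • a) = r • rotZ θ a := fun θ r a => by
    ext i; fin_cases i <;> simp [rotZ] <;> ring
  have key : ∀ t x, u ((c * d) ^ 2 * t) (rdil b d β (rdil a c α x)) =
      u ((c * d) ^ 2 * t) (rdil a c α (rdil b d β x)) := by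
    intro t x
    simp only [rdil]
    have e1 := h₁ t x
    rw [← h₂ (c ^ 2 * t) (a + c • rotZ α (x - a))] at e1
    have e2 := h₂ t x
    rw [← h₁ (d ^ 2 * t) (b + d • rotZ β (x - b))] at e2
    rw [rotZ_smul_vec, smul_smul] at e1 e2
    have e3 := e1.trans e2.symm
    have ht1 : d ^ 2 * (c ^ 2 * t) = (c * d) ^ 2 * t := by ring
    have ht2 : c ^ 2 * (d ^ 2 * t) = (c * d) ^ 2 * t := by ring
    rw [ht1, ht2, mul_comm d c, RotationOrder.rotZ_comm (-β) (-α)] at e3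
    exact rotZ_injective _ (rotZ_injective _ (smul_right_injective _ (mul_ne_zero hc hd) e3))
  intro s y
  set t : ℝ := s / (c * d) ^ 2 with ht
  set x : E3 := rdilInv a c α (rdilInv b d β y) with hx
  have hcd : (c * d) ^ 2 ≠ 0 := pow_ne_zero 2 (mul_ne_zero hc hd)
  have hts : (c * d) ^ 2 * t = s := by rw [ht]; field_simp
  have hxy : rdil b d β (rdil a c α x) = y := by
    rw [hx, rdil_rdilInv a hc, rdil_rdilInv b hd]
  have k := key t x
  rw [rdil_comm_defect a b c d α β x, hts, hxy] at k
  exact k.symm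

/-- `w ≠ 0` for distinct centres and factors `≠ 1`. [folklore] -/
theorem commVec_ne_zero {a b : E3} {c d : ℝ} (α β : ℝ) (hab : a ≠ b) (hc : 0 < c) (hc1 : c ≠ 1)
    (hd : 0 < d) (hd1 : d ≠ 1) : commVec a b c d α β ≠ 0 := by
  intro h
  change ((a - b) - d • rotZ β (a - b)) - c • rotZ α ((a - b) - d • rotZ β (a - b)) = 0 at h
  have hz : (a - b) - d • rotZ β (a - b) ≠ 0 := by
    intro hz
    have e := eq_zero_of_smul_rotZ_eq hd hd1 (sub_eq_zero.1 hz).symm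
    exact hab (sub_eq_zero.1 e)
  exact hz (eq_zero_of_smul_rotZ_eq hc hc1 (sub_eq_zero.1 h).symm)

/-- **ROW R-2c-T holds** (closure on census A13). -/
theorem row_R2cT_holds : Row_R2cT := by
  intro C u a b c d α β hu hab hc hc1 hd hd1 h₁ h₂
  have hw := commVec_ne_zero α β hab hc hc1 hd hd1
  have hT := translate_of_two_rdss_centres hc.ne' hd.ne' h₁ h₂
  exact Summit.NavierStokesRegularity.NavierStokesRegularity.Theorems.ScenarioCensus.PeriodicGauge.periodic_typeI_liouville_genuine
    C u hu _ hw (fun t _ x => hT t x)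

/-- Reading: a NON-TRIVIAL Type-I ancient mild field has at most one centre among all its vertical-axis
rotated-DSS symmetries. -/
theorem rdssCentre_unique_of_nontrivial {C : ℝ} {u : ℝ → E3 → E3} (hu : IsTypeIAncientMild C u)
    (hne : ∃ t < 0, ∃ x, u t x ≠ 0) {a b : E3} {c d α β : ℝ}
    (hc : 0 < c) (hc1 : c ≠ 1) (hd : 0 < d) (hd1 : d ≠ 1)
    (h₁ : IsRdssAbout a c α u) (h₂ : IsRdssAbout b d β u) : a = b := by
  by_contra hab
  obtain ⟨t, ht, x, hx⟩ := hne
  exact hx (row_R2cT_holds C u a b c d α β hu hab hc hc1 hd hd1 h₁ h₂ t ht x)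

/-! #### DSS about a space–time point; ROW D-ap-T (apex in the open past) -/

/-- `u` is **discretely self-similar with factor `c` about the space–time point `(t₁, x₁)`**:
`c u(t₁ + c²(t − t₁), x₁ + c(x − x₁)) = u(t, x)` for all `t, x`.  For `t₁ = 0` this is `IsDssAbout x₁ c u`
(`isDssAboutST_zero_iff`). [folklore] -/
def IsDssAboutST (t₁ : ℝ) (x₁ : E3) (c : ℝ) (u : ℝ → E3 → E3) : Prop :=
  ∀ t x, c • u (t₁ + c ^ 2 * (t - t₁)) (x₁ + c • (x - x₁)) = u t x

/-- Space–time DSS about `(0, x₁)`, unfolded. -/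
theorem isDssAboutST_zero_iff {x₁ : E3} {c : ℝ} {u : ℝ → E3 → E3} :
    IsDssAboutST 0 x₁ c u ↔ IsDssAbout x₁ c u := by
  simp only [IsDssAboutST, IsDssAbout, zero_add, sub_zero]

/-- ROW D-ap-T («apex in the open past»): a Type-I ancient mild field that is DSS (factor `c > 0`, `c ≠ 1`)
about a space–time point `(t₁, x₁)` with `t₁ < 0` vanishes on the past. -/
def Row_DapT : Prop :=
  ∀ (C : ℝ) (u : ℝ → E3 → E3) (t₁ : ℝ) (x₁ : E3) (c : ℝ),
    IsTypeIAncientMild C u → t₁ < 0 → 0 < c → c ≠ 1 → IsDssAboutST t₁ x₁ c u → ∀ t < 0, ∀ x, u t x = 0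

/-- DSS about `(t₁, x₁)` with factor `c` is DSS about it with factor `c⁻¹`. [folklore] -/
theorem IsDssAboutST.inv {t₁ : ℝ} {x₁ : E3} {c : ℝ} {u : ℝ → E3 → E3} (hc : c ≠ 0)
    (h : IsDssAboutST t₁ x₁ c u) : IsDssAboutST t₁ x₁ c⁻¹ u := by
  intro t x
  have e := h (t₁ + c⁻¹ ^ 2 * (t - t₁)) (x₁ + c⁻¹ • (x - x₁))
  have hc2 : c ^ 2 ≠ 0 := pow_ne_zero 2 hc
  have e1 : t₁ + c ^ 2 * ((t₁ + c⁻¹ ^ 2 * (t - t₁)) - t₁) = t := by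
    rw [add_sub_cancel_left, inv_pow, ← mul_assoc, mul_inv_cancel₀ hc2, one_mul, add_sub_cancel]
  have e2 : x₁ + c • ((x₁ + c⁻¹ • (x - x₁)) - x₁) = x := by
    rw [add_sub_cancel_left, smul_smul, mul_inv_cancel₀ hc, one_smul, add_sub_cancel]
  rw [e1, e2] at e
  rw [← e, smul_smul, inv_mul_cancel₀ hc, one_smul]

/-- Iterating the dilation `k` times. [folklore] -/
theorem IsDssAboutST.iterate {t₁ : ℝ} {x₁ : E3} {q : ℝ} {u : ℝ → E3 → E3} (h : IsDssAboutST t₁ x₁ q u) :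
    ∀ (k : ℕ) (t : ℝ) (x : E3),
      q ^ k • u (t₁ + q ^ (2 * k) * (t - t₁)) (x₁ + q ^ k • (x - x₁)) = u t x := by
  intro k
  induction k with
  | zero =>
    intro t x
    simp only [pow_zero, mul_zero, one_mul, one_smul, add_sub_cancel]
  | succ k ih =>
    intro t x
    have e := h (t₁ + q ^ (2 * k) * (t - t₁)) (x₁ + q ^ k • (x - x₁))
    have e1 : t₁ + q ^ 2 * ((t₁ + q ^ (2 * k) * (t - t₁)) - t₁) = t₁ + q ^ (2 * (k + 1)) * (t - t₁) := by
      ring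
    have e2 : x₁ + q • ((x₁ + q ^ k • (x - x₁)) - x₁) = x₁ + q ^ (k + 1) • (x - x₁) := by
      rw [add_sub_cancel_left, smul_smul, ← pow_succ']
    rw [e1, e2] at e
    rw [← ih t x, ← e, smul_smul, ← pow_succ]

/-- The iteration towards the regular fixed point kills the field when the factor is `< 1`. [folklore] -/
theorem eq_zero_of_dssAboutST_lt_one {C : ℝ} {u : ℝ → E3 → E3} (hdec : HasTypeITimeDecay C u)
    {t₁ : ℝ} (ht₁ : t₁ < 0) {x₁ : E3} {q : ℝ} (hq0 : 0 < q) (hq1 : q < 1)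
    (h : IsDssAboutST t₁ x₁ q u) : ∀ t < 0, ∀ x, u t x = 0 := by
  intro t ht x
  have hC : 0 ≤ C := by
    have e := hdec (-1) (by norm_num) 0
    rw [neg_neg, Real.sqrt_one, div_one] at e
    exact (norm_nonneg _).trans e
  set T : ℝ := max t t₁ with hT
  have hT0 : T < 0 := max_lt ht ht₁
  set M : ℝ := C / Real.sqrt (-T) with hM
  have hbound : ∀ k : ℕ, ‖u t x‖ ≤ q ^ k * M := by
    intro k
    have hq2 : 0 ≤ q ^ (2 * k) := pow_nonneg hq0.le _
    have hq3 : q ^ (2 * k) ≤ 1 := pow_le_one₀ hq0.le hq1.le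
    have hP : t₁ + q ^ (2 * k) * (t - t₁) ≤ T := by
      rcases le_or_gt t t₁ with htt | htt
      · have : q ^ (2 * k) * (t - t₁) ≤ 0 := mul_nonpos_of_nonneg_of_nonpos hq2 (by linarith)
        calc t₁ + q ^ (2 * k) * (t - t₁) ≤ t₁ := by linarith
          _ ≤ T := le_max_right _ _
      · have : q ^ (2 * k) * (t - t₁) ≤ 1 * (t - t₁) :=
          mul_le_mul_of_nonneg_right hq3 (by linarith)
        calc t₁ + q ^ (2 * k) * (t - t₁) ≤ t := by linarith
          _ ≤ T := le_max_left _ _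
    have hPneg : t₁ + q ^ (2 * k) * (t - t₁) < 0 := lt_of_le_of_lt hP hT0
    have e := h.iterate k t x
    have hn : ‖u t x‖ = q ^ k * ‖u (t₁ + q ^ (2 * k) * (t - t₁)) (x₁ + q ^ k • (x - x₁))‖ := by
      rw [← e, norm_smul, Real.norm_of_nonneg (pow_nonneg hq0.le k)]
    have hd := hdec _ hPneg (x₁ + q ^ k • (x - x₁))
    have hmono : C / Real.sqrt (-(t₁ + q ^ (2 * k) * (t - t₁))) ≤ M := by
      rw [hM]
      exact div_le_div_of_nonneg_left hC (Real.sqrt_pos.2 (by linarith))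
        (Real.sqrt_le_sqrt (by linarith))
    rw [hn]
    exact mul_le_mul_of_nonneg_left (hd.trans hmono) (pow_nonneg hq0.le k)
  have hlim : Tendsto (fun k : ℕ => q ^ k * M) atTop (𝓝 (0 * M)) :=
    (tendsto_pow_atTop_nhds_zero_of_lt_one hq0.le hq1).mul_const M
  rw [zero_mul] at hlim
  have h0 : ‖u t x‖ ≤ 0 := ge_of_tendsto' hlim hbound
  exact norm_le_zero_iff.1 h0

/-- **ROW D-ap-T holds** (no engine: iteration towards the regular fixed point). -/
theorem row_DapT_holds : Row_DapT := by
  intro C u t₁ x₁ c hu ht₁ hc hc1 h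
  rcases lt_or_gt_of_ne hc1 with hlt | hgt
  · exact eq_zero_of_dssAboutST_lt_one hu.hasTypeITimeDecay ht₁ hc hlt h
  · exact eq_zero_of_dssAboutST_lt_one hu.hasTypeITimeDecay ht₁ (inv_pos.2 hc)
      (inv_lt_one_of_one_lt₀ hgt) (h.inv hc.ne')

/-- Reading: the apex of a NON-TRIVIAL DSS Type-I ancient mild field is not in the open past. -/
theorem apex_not_in_past_of_nontrivial {C : ℝ} {u : ℝ → E3 → E3} (hu : IsTypeIAncientMild C u)
    (hne : ∃ t < 0, ∃ x, u t x ≠ 0) {t₁ : ℝ} {x₁ : E3} {c : ℝ} (hc : 0 < c) (hc1 : c ≠ 1)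
    (h : IsDssAboutST t₁ x₁ c u) : 0 ≤ t₁ := by
  by_contra ht₁
  push Not at ht₁
  obtain ⟨t, ht, x, hx⟩ := hne
  exact hx (row_DapT_holds C u t₁ x₁ c hu ht₁ hc hc1 h t ht x)

end Rev2

end Summit.NavierStokesRegularity.NavierStokesRegularity.Theorems.ScenarioCensus.ScalingSpectrum

namespace Summit.NavierStokesRegularity.NavierStokesRegularity.Theorems.ScenarioCensus

/-! ## Census KEYS (ns `…Theorems.ScenarioCensus`): members of rows D7 / R4 decided by the scaling-spectrum meter — TREE-decided -/

/-- **Cell D7bi** (Type-I ancient mild · bi-DSS with two factors `c, d` whose log-ratio is irrational ⇒ `u ≡ 0` on `t < 0`): `:= ScalingSpectrum.Row_DbiT`.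
DECIDED (a named instance of D7nc: `ScalingSpectrum.row_DbiT_of_row_DncT`). -/
def Row_D7bi : Prop := ScalingSpectrum.Row_DbiT
/-- D7bi is EXCLUDED (decided in the tree): `ScalingSpectrum.row_DbiT_holds`. -/
theorem row_D7bi_excluded : Row_D7bi := ScalingSpectrum.row_DbiT_holds

/-- **Cell D7nc** (log-scaling group not cyclic ⇒ `u ≡ 0`; dense form `ScalingSpectrum.Row_DdenseT` / `row_DdenseT_holds`): `:= ScalingSpectrum.Row_DncT`. DECIDED. -/
def Row_D7nc : Prop := ScalingSpectrum.Row_DncT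
/-- D7nc is EXCLUDED (decided in the tree): `ScalingSpectrum.row_DncT_holds`. -/
theorem row_D7nc_excluded : Row_D7nc := ScalingSpectrum.row_DncT_holds

/-- **Cell D7cc** (DSS about TWO DISTINCT centres ⇒ `u ≡ 0`): `:= ScalingSpectrum.Row_D2cT`. DECIDED. -/
def Row_D7cc : Prop := ScalingSpectrum.Row_D2cT
/-- D7cc is EXCLUDED (decided in the tree): `ScalingSpectrum.row_D2cT_holds`. -/
theorem row_D7cc_excluded : Row_D7cc := ScalingSpectrum.row_D2cT_holds

/-- **Cell D7ap** (DSS about a space–time apex `(t₁, x₁)` with `t₁ < 0` ⇒ `u ≡ 0`): `:= ScalingSpectrum.Row_DapT`. DECIDED. -/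
def Row_D7ap : Prop := ScalingSpectrum.Row_DapT
/-- D7ap is EXCLUDED (decided in the tree): `ScalingSpectrum.row_DapT_holds`. -/
theorem row_D7ap_excluded : Row_D7ap := ScalingSpectrum.row_DapT_holds

/-- **Cell R4cc** (rotated-DSS with vertical rotation axes about TWO DISTINCT centres ⇒ `u ≡ 0`): `:= ScalingSpectrum.Row_R2cT`. DECIDED. -/
def Row_R4cc : Prop := ScalingSpectrum.Row_R2cT
/-- R4cc is EXCLUDED (decided in the tree): `ScalingSpectrum.row_R2cT_holds`. -/
theorem row_R4cc_excluded : Row_R4cc := ScalingSpectrum.row_R2cT_holds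

end Summit.NavierStokesRegularity.NavierStokesRegularity.Theorems.ScenarioCensus

end
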